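import Literature.NumberTheory.Irrationality.RivoalZudilin2020.DenominatorsBricks
import Literature.NumberTheory.Transcendental.TaylorCoeffPadicDiv
import HarnessLib

/-!
# Rivoal–Zudilin 2020, Proposition 1 (ii): the `p`-adic saving `Φ_n` (`p > 2√n`)

Topic `Literature/NumberTheory/Irrationality/RivoalZudilin2020`; proofs-only companion (over `ℚ`) of
`TwoIrrationalOddZetaValues.lean`, continuation of `DenominatorsBricks.lean`. Source: T. Rivoal, W. Zudilin,
*A note on odd zeta values*, Sém. Lothar. Combin. **81** (2020) B81b = arXiv:1803.03160 [RivoalZudilin2020], §3,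
proof of Proposition 1 (ii), second half (arXiv pp. 5–6):

"The numbers `(F(t)(t+m)^5)_{t=−m} = (2n+2m)!(4n−2m)!/(m!^6(n−m)!^6)` for `m = 0,1,…,n`, have a large common
factor. Indeed … `v_p((2n+2m)!(4n−2m)!/(m!^6(n−m)!^6)) = ρ(n/p, m/p) ≥ ρ₀(n/p)` for an odd prime `p > 2√n`,
where `ρ(x,y) := ⌊2x+2y⌋ + ⌊4x−2y⌋ − 6⌊y⌋ − 6⌊x−y⌋` … and `ρ₀(x) := min_y ρ(x,y)` … can be explicitly given on
`0 ≤ x < 1` by `0, 1, 2, 3, 4` on `[0,⅓), [⅓,½), [½,⅔), [⅔,⅚), [⅚,1)`. … Following the lines of the proof of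
[zud3], we see that these inclusions imply `Φ_n^{−1} d_n^k (1/k!)(F(t)(t+m)^5)^{(k)}_{t=−m} ∈ ℤ` for
`m = 0,1,…,n` and all integers `k ≥ 0`. … Combining these inclusions with the representation
`R(t) = (2t+n)F(t)³G(t)^{A−15}` and using Leibniz's rule for differentiating products, we conclude that …
`Φ_n^{−3} d_n^{A−j} p_{j,m} ∈ ℤ`."

## Rendering ("the lines of the proof of [zud3]" = [Zudilin2004, Lemmas 17–18], in the sharp divided form
`IsDOrdDiv` of `Transcendental/TaylorCoeffPadicDiv.lean`)

* `Fcompact n m t = ∏_{0 ≤ i ≤ 6n, i ≠ 2n+2m} (2t − 2n + i) · ∏_{k ≤ n, k ≠ m} (t+k)^{−6}` — `F(t)(t+m)^5` as a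
  product of doubled linear factors (`(2t−2n)_{6n+1} = 2^{6n+1}(t−n)_n (t)_{n+1} (t+n+1)_n (t−n+½)_{3n}`, the
  source's second expression for `R`); `Fcompact_eq_Fbrick` identifies it with the brick form off the poles
  `−k`, `k ≠ m` (hence near `−m`);
* for a prime `p` with `p² > 4n`, at `t = −m`: each factor `2t−2n+i` has `IsDOrdDiv` exponent `[p ∣ i−2n−2m]`
  and each `(t+k)^{−1}` exponent `−[p ∣ k−m]` (`0 < |i−2n−2m|, |k−m| < p²`), so `F(t)(t+m)^5` has exponent
  `#{…} − 6#{…} = ⌊(2n+2m)/p⌋ + ⌊(4n−2m)/p⌋ − 6⌊m/p⌋ − 6⌊(n−m)/p⌋ = ρ(n/p, m/p)` (`rhoZ`; `Fbrick_isDOrdDiv`),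
  `G(t)(t+m)` has exponent `ord_p n! − ⌊m/p⌋ − ⌊(n−m)/p⌋ ≥ 0`, `2t+n` exponent `≥ 0`;
* `rho0Nat n p` is the printed step function `ρ₀(n/p)` in integer arithmetic (`{n/p} = (n mod p)/p`), and
  `rho0Nat_le_rhoZ` is "`ρ(n/p,m/p) ≥ ρ₀(n/p)`" (proof: with `b = m mod p`, `b' = (n−m) mod p`,
  `ρ = ⌊(4b+2b')/p⌋ + ⌊(2b+4b')/p⌋ > 6(b+b')/p − 2 ≥ 6{n/p} − 2`, and `ρ₀(x) = max(0, ⌈6{x}⌉ − 2)`-type case check);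
* `padicOrdGe_divDeriv_RregBrick`: **`ord_p (1/a!)(R(t)(t+m)^A)^{(a)}|_{t=−m} ≥ 3ρ₀(n/p) − a`** for every `a`
  and every prime `p` with `p² > 4n` ("`Φ_n^{−3} d_n^{A−j} p_{j,m} ∈ ℤ`" prime by prime; the assembly with
  `d_n` and the typed `Φ_n`, `p_{j,m}` is in `DenominatorsProofs.lean`).

HONEST FRAMING (cells pub-zeta5 / zeta5-irr): systematic search; no irrationality claim unless certified —
`p`-adic valuations of Taylor coefficients of a rational function; nothing here concerns `ζ(5)`.
-/

noncomputable section

open Finset Filter Literature.Analysis.Calculus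
open Literature.NumberTheory.Transcendental
open scoped Nat Topology

namespace Literature.NumberTheory.Irrationality.RivoalZudilin2020

/-! ### The compact form of `F(t)(t+m)^5` -/

/-- `F(t)(t+m)^5 = ∏_{0 ≤ i ≤ 6n, i ≠ 2n+2m} (2t − 2n + i) · ∏_{k ≤ n, k ≠ m} (t+k)^{−6}` (from
`2·(t)_{n+1}^6 · F(t) = (2t−2n)_{6n+1}`). [cite: RivoalZudilin2020, §2 (second expression of R(t), (2t−2n)_{6n+1})] -/
def Fcompact (n m : ℕ) (t : ℚ) : ℚ :=
  (∏ i ∈ (range (6 * n + 1)).filter (fun i => i ≠ 2 * n + 2 * m), (2 * t - 2 * n + i)) *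
    ∏ l ∈ (range (n + 1)).filter (fun l => l ≠ m), ((t + l)⁻¹) ^ 6

/-- Splitting a product over `range (2M+1)` into even and odd indices. [folklore] -/
private theorem prod_range_parity {R : Type*} [CommRing R] (f : ℕ → R) (M : ℕ) :
    ∏ i ∈ range (2 * M + 1), f i = (∏ i ∈ range (M + 1), f (2 * i)) * ∏ i ∈ range M, f (2 * i + 1) := by
  induction M with
  | zero => simp
  | succ M ih =>
    rw [show 2 * (M + 1) + 1 = 2 * M + 1 + 1 + 1 by ring, prod_range_succ, prod_range_succ, ih,
      prod_range_succ (fun i => f (2 * i)) (M + 1), prod_range_succ (fun i => f (2 * i + 1)) M,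
      show 2 * (M + 1) = 2 * M + 1 + 1 by ring]
    ring

/-- The product over `range (n+1)` of `if x = m then 1 else g x` is the product of `g` over `x ≠ m`. [folklore] -/
private theorem prod_ite_eq_prod_filter (n m : ℕ) (g : ℕ → ℚ) :
    ∏ x ∈ range (n + 1), (if x = m then 1 else g x) = ∏ x ∈ (range (n + 1)).filter (fun l => l ≠ m), g x := by
  rw [prod_filter]
  refine prod_congr rfl fun x _ => ?_
  by_cases h : x = m <;> simp [h]

/-- The numerator of the compact form, off nothing: for `m ≤ n`,
`∏_{i ≤ 6n, i ≠ 2n+2m} (2t−2n+i) = 2^{6n} · ∏_{l<n}(t−n+l) · ∏_{k ≤ n, k ≠ m}(t+k) · ∏_{l<n}(t+n+1+l) · ∏_{i<3n}(t−n+½+i)`.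
[cite: RivoalZudilin2020, §2 (the two expressions of R(t))] -/
theorem prod_compact_numerator (n : ℕ) {m : ℕ} (hm : m ≤ n) (t : ℚ) :
    ∏ i ∈ (range (6 * n + 1)).filter (fun i => i ≠ 2 * n + 2 * m), (2 * t - 2 * n + i)
      = 2 ^ (6 * n) * (∏ l ∈ range n, (t - n + l)) * (∏ k ∈ (range (n + 1)).filter (fun l => l ≠ m), (t + k)) *
          (∏ l ∈ range n, (t + n + 1 + l)) * ∏ i ∈ range (3 * n), (t - n + 1 / 2 + i) := by
  -- `if`-form and parity split
  set g : ℕ → ℚ := fun i => if i = 2 * n + 2 * m then 1 else (2 * t - 2 * n + i) with hg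
  have h1 : ∏ i ∈ (range (6 * n + 1)).filter (fun i => i ≠ 2 * n + 2 * m), (2 * t - 2 * n + i)
      = ∏ i ∈ range (6 * n + 1), g i := by
    rw [prod_filter]
    refine prod_congr rfl fun i _ => ?_
    by_cases h : i = 2 * n + 2 * m <;> simp [hg, h]
  rw [h1, show 6 * n + 1 = 2 * (3 * n) + 1 by ring, prod_range_parity g (3 * n)]
  -- evens
  have hev : ∏ i ∈ range (3 * n + 1), g (2 * i)
      = ∏ i ∈ range (3 * n + 1), (if i = n + m then (1 : ℚ) else 2 * (t - n + i)) := by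
    refine prod_congr rfl fun i _ => ?_
    by_cases h : i = n + m
    · rw [if_pos h, hg]; simp [h]; intro h'; omega
    · rw [if_neg h, hg]
      simp only
      rw [if_neg (by omega)]
      push_cast; ring
  -- odds
  have hodd : ∏ i ∈ range (3 * n), g (2 * i + 1) = ∏ i ∈ range (3 * n), (2 : ℚ) * (t - n + 1 / 2 + i) := by
    refine prod_congr rfl fun i _ => ?_
    rw [hg]
    simp only
    rw [if_neg (by omega)]
    push_cast; ring
  rw [hev, hodd]
  -- split the evens into three blocks
  set h : ℕ → ℚ := fun i => if i = n + m then (1 : ℚ) else 2 * (t - n + i) with hh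
  have hsplit : ∏ i ∈ range (3 * n + 1), h i
      = (∏ x ∈ range n, h x) * ((∏ x ∈ range (n + 1), h (n + x)) * ∏ x ∈ range n, h (n + (n + 1 + x))) := by
    rw [show 3 * n + 1 = n + ((n + 1) + n) by ring, prod_range_add, prod_range_add]
  have hb1 : ∏ x ∈ range n, h x = ∏ x ∈ range n, (2 : ℚ) * (t - n + x) := by
    refine prod_congr rfl fun x hx => ?_
    have := mem_range.1 hx
    rw [hh]; simp only; rw [if_neg (by omega)]
  have hb2 : ∏ x ∈ range (n + 1), h (n + x) = ∏ x ∈ range (n + 1), (if x = m then (1 : ℚ) else 2 * (t + x)) := by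
    refine prod_congr rfl fun x _ => ?_
    rw [hh]; simp only
    by_cases hx : x = m
    · rw [if_pos (by omega), if_pos hx]
    · rw [if_neg (by omega), if_neg hx]; push_cast; ring
  have hb3 : ∏ x ∈ range n, h (n + (n + 1 + x)) = ∏ x ∈ range n, (2 : ℚ) * (t + n + 1 + x) := by
    refine prod_congr rfl fun x _ => ?_
    rw [hh]; simp only; rw [if_neg (by omega)]; push_cast; ring
  rw [hsplit, hb1, hb2, hb3, prod_ite_eq_prod_filter]
  -- pull out the powers of `2`
  have hcard : ((range (n + 1)).filter (fun l => l ≠ m)).card = n := by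
    rw [filter_ne', card_erase_of_mem (mem_range.2 (by omega)), card_range]; rfl
  simp only [prod_mul_distrib, prod_const, card_range, hcard]
  ring

/-- `∏_{i<3n} (t−n+½+i) = ∏_{c ∈ {−n,0,n}} ∏_{j<n} (t + c + ½ + j)` (three blocks of `n`). [folklore] -/
private theorem prod_half_blocks (n : ℕ) (t : ℚ) :
    ∏ i ∈ range (3 * n), (t - n + 1 / 2 + i)
      = (∏ j ∈ range n, (t + ((((-(n : ℤ) : ℤ)) : ℚ) + 1 / 2 + j))) *
          ((∏ j ∈ range n, (t + (((0 : ℤ) : ℚ) + 1 / 2 + j))) *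
            ∏ j ∈ range n, (t + (((n : ℤ) : ℚ) + 1 / 2 + j))) := by
  rw [show 3 * n = n + (n + n) by ring, prod_range_add, prod_range_add]
  congr 1
  · exact prod_congr rfl fun j _ => by push_cast; ring
  · congr 1
    · exact prod_congr rfl fun j _ => by push_cast; ring
    · exact prod_congr rfl fun j _ => by push_cast; ring

/-- **The compact form equals the brick form** off the poles `−k`, `k ≤ n`, `k ≠ m` (in particular near `−m`).
[cite: RivoalZudilin2020, §2–§3 (R(t) = (2t+n)F(t)³G(t)^{A−15} with both expressions of R)] -/
theorem Fcompact_eq_Fbrick (n : ℕ) {m : ℕ} (hm : m ≤ n) {t : ℚ}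
    (ht : ∀ l ∈ (range (n + 1)).filter (fun l => l ≠ m), t + l ≠ 0) :
    Fcompact n m t = Fbrick n m t := by
  have hQ : ∏ l ∈ (range (n + 1)).filter (fun l => l ≠ m), (t + (l : ℚ)) ≠ 0 :=
    prod_ne_zero_iff.2 fun l hl => ht l hl
  have hf : (n ! : ℚ) ≠ 0 := by exact_mod_cast Nat.factorial_ne_zero n
  rw [Fcompact, prod_compact_numerator n hm t, Fbrick, Greg_eq n hm, prod_half_blocks, prod_pow,
    prod_inv_distrib]
  set Q := ∏ l ∈ (range (n + 1)).filter (fun l => l ≠ m), (t + (l : ℚ)) with hQdef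
  simp only [polyBrick, halfBrick]
  push_cast
  field_simp
  ring

/-- The compact and brick forms agree near `−m`. [cite: RivoalZudilin2020, §3 (proof of Proposition 1 (ii))] -/
theorem Fcompact_eventuallyEq_Fbrick (n : ℕ) {m : ℕ} (hm : m ≤ n) :
    Fcompact n m =ᶠ[𝓝 (-(m : ℚ))] Fbrick n m := by
  have hne : ∀ l ∈ (range (n + 1)).filter (fun l => l ≠ m), ∀ᶠ t : ℚ in 𝓝 (-(m : ℚ)), t + l ≠ 0 := by
    intro l hl
    have hlm : l ≠ m := (mem_filter.1 hl).2
    refine ((continuous_add_const (l : ℚ)).continuousAt).eventually_ne ?_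
    rw [show (-(m : ℚ) + l) = ((l : ℤ) - m : ℤ) by push_cast; ring]
    exact_mod_cast sub_ne_zero.2 (by exact_mod_cast hlm : (l : ℤ) ≠ m)
  filter_upwards [(eventually_all_finset _).2 hne] with t ht
  exact Fcompact_eq_Fbrick n hm ht

/-! ### The printed step function `ρ₀` and the floor expression `ρ` in integer arithmetic -/

/-- `ρ₀(n/p)` in integer arithmetic: with `a = n mod p` (so `{n/p} = a/p`), the printed step function
`0, 1, 2, 3, 4` on `[0,⅓), [⅓,½), [½,⅔), [⅔,⅚), [⅚,1)`. [cite: RivoalZudilin2020, §3 (proof of Proposition 1 (ii), ρ₀)] -/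
def rho0Nat (n p : ℕ) : ℕ :=
  if 3 * (n % p) < p then 0
  else if 2 * (n % p) < p then 1
  else if 3 * (n % p) < 2 * p then 2
  else if 6 * (n % p) < 5 * p then 3
  else 4

/-- `ρ₀ ≤ 4`. [cite: RivoalZudilin2020, §3 (proof of Proposition 1 (ii), ρ₀)] -/
theorem rho0Nat_le_four (n p : ℕ) : rho0Nat n p ≤ 4 := by
  unfold rho0Nat; split_ifs <;> omega

/-- `ρ(n/p, m/p) = ⌊(2n+2m)/p⌋ + ⌊(4n−2m)/p⌋ − 6⌊m/p⌋ − 6⌊(n−m)/p⌋` (for `m ≤ n`, natural-number divisions).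
[cite: RivoalZudilin2020, §3 (proof of Proposition 1 (ii), ρ(x,y))] -/
def rhoZ (n m p : ℕ) : ℤ :=
  (((2 * n + 2 * m) / p : ℕ) : ℤ) + (((4 * n - 2 * m) / p : ℕ) : ℤ) - 6 * ((m / p : ℕ) : ℤ) - 6 * (((n - m) / p : ℕ) : ℤ)

/-- **`ρ(n/p, m/p) ≥ ρ₀(n/p)`** for `0 ≤ m ≤ n` and `p ≥ 1`. Proof: with `m = q₁p + b`, `n − m = q₂p + b'`
one has `ρ = ⌊(4b+2b')/p⌋ + ⌊(2b+4b')/p⌋ =: U + V`, `(U+V+2)p > 6(b+b') ≥ 6(n mod p)`, and the thresholds of `ρ₀`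
are `6(n mod p) ≥ 2p, 3p, 4p, 5p`. [cite: RivoalZudilin2020, §3 (proof of Proposition 1 (ii), "ρ(n/p,m/p) ≥ ρ₀(n/p)")] -/
theorem rho0Nat_le_rhoZ {n m p : ℕ} (hp : 0 < p) (hm : m ≤ n) : (rho0Nat n p : ℤ) ≤ rhoZ n m p := by
  -- write `m = q₁ p + b`, `n - m = q₂ p + b'`
  set b := m % p with hb
  set b' := (n - m) % p with hb'
  set q₁ := m / p with hq₁
  set q₂ := (n - m) / p with hq₂
  have hm' : m = q₁ * p + b := by rw [hq₁, hb, Nat.div_add_mod' m p]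
  have hnm : n - m = q₂ * p + b' := by rw [hq₂, hb', Nat.div_add_mod' (n - m) p]
  have hbp : b < p := Nat.mod_lt _ hp
  have hb'p : b' < p := Nat.mod_lt _ hp
  set U := (4 * b + 2 * b') / p with hU
  set V := (2 * b + 4 * b') / p with hV
  have h1 : (2 * n + 2 * m) / p = 4 * q₁ + 2 * q₂ + U := by
    have e : 2 * n + 2 * m = (4 * b + 2 * b') + (4 * q₁ + 2 * q₂) * p := by
      have : n = m + (n - m) := by omega
      rw [this, hnm]; rw [hm'] ; ring
    rw [e, Nat.add_mul_div_right _ _ hp]; omega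
  have h2 : (4 * n - 2 * m) / p = 2 * q₁ + 4 * q₂ + V := by
    have e : 4 * n - 2 * m = (2 * b + 4 * b') + (2 * q₁ + 4 * q₂) * p := by
      have : n = m + (n - m) := by omega
      zify [show 2 * m ≤ 4 * n by omega] at *
      rw [this, hnm, hm']; ring
    rw [e, Nat.add_mul_div_right _ _ hp]; omega
  have hrho : rhoZ n m p = (U : ℤ) + V := by
    rw [rhoZ, h1, h2, ← hq₁, ← hq₂]; push_cast; ring
  rw [hrho]
  -- `(U+1)p > 4b+2b'`, `(V+1)p > 2b+4b'`
  have hU1 : 4 * b + 2 * b' < (U + 1) * p := by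
    have := Nat.lt_div_mul_add (a := 4 * b + 2 * b') hp; rw [← hU] at this; linarith
  have hV1 : 2 * b + 4 * b' < (V + 1) * p := by
    have := Nat.lt_div_mul_add (a := 2 * b + 4 * b') hp; rw [← hV] at this; linarith
  -- `n mod p ≤ b + b'`
  have ha : n % p ≤ b + b' := by
    have : n = m + (n - m) := by omega
    rw [this, Nat.add_mod, ← hb, ← hb']
    exact (Nat.mod_le _ _)
  have key : 6 * (n % p) < (U + V + 2) * p := by nlinarith
  -- case check on the thresholds of `ρ₀`
  have hUV : ∀ T : ℕ, T ≤ 4 → (T + 1) * p ≤ 6 * (n % p) → T ≤ U + V := by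
    intro T hT hTp
    by_contra hc
    have : (U + V + 2) * p ≤ (T + 1) * p := Nat.mul_le_mul_right p (by omega)
    omega
  have hcases : rho0Nat n p ≤ U + V := by
    unfold rho0Nat
    by_cases c1 : 3 * (n % p) < p
    · rw [if_pos c1]; exact Nat.zero_le _
    rw [if_neg c1]
    by_cases c2 : 2 * (n % p) < p
    · rw [if_pos c2]; exact hUV 1 (by norm_num) (by omega)
    rw [if_neg c2]
    by_cases c3 : 3 * (n % p) < 2 * p
    · rw [if_pos c3]; exact hUV 2 (by norm_num) (by omega)
    rw [if_neg c3]
    by_cases c4 : 6 * (n % p) < 5 * p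
    · rw [if_pos c4]; exact hUV 3 (by norm_num) (by omega)
    rw [if_neg c4]
    exact hUV 4 (by norm_num) (by omega)
  exact_mod_cast hcases

/-! ### Counting multiples of `p` -/

/-- `#{i ≤ 6n, i ≠ 2n+2m : p ∣ i − 2n − 2m} = ⌊(2n+2m)/p⌋ + ⌊(4n−2m)/p⌋` (for `m ≤ n`).
[cite: RivoalZudilin2020, §3 (proof of Proposition 1 (ii), v_p via ⌊·⌋)] -/
theorem card_filter_compact_num (n : ℕ) {m : ℕ} (hm : m ≤ n) {p : ℕ} (hp : 0 < p) :
    ((((range (6 * n + 1)).filter (fun i => i ≠ 2 * n + 2 * m)).filter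
        (fun i : ℕ => (p : ℤ) ∣ (i : ℤ) - 2 * n - 2 * m)).card : ℤ)
      = (((2 * n + 2 * m) / p : ℕ) : ℤ) + (((4 * n - 2 * m) / p : ℕ) : ℤ) := by
  have hp' : (0 : ℤ) < p := by exact_mod_cast hp
  -- the full count, including `i = 2n+2m`
  have hfull := card_filter_dvd_range (-(2 * (n : ℤ) + 2 * m)) (6 * n + 1) hp'
  have e1 : (-(2 * (n : ℤ) + 2 * m) + ((6 * n + 1 : ℕ) : ℤ) - 1) = ((4 * n - 2 * m : ℕ) : ℤ) := by
    push_cast [Nat.cast_sub (show 2 * m ≤ 4 * n by omega)]; ring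
  have e2 : (-(2 * (n : ℤ) + 2 * m) - 1) = -(((2 * n + 2 * m : ℕ) : ℤ)) - 1 := by push_cast; ring
  rw [e1, e2, Int.neg_sub_one_ediv_eq _ hp', ← Int.natCast_div, ← Int.natCast_div] at hfull
  -- the filters agree, and `2n+2m` is counted in the full one
  set T := (range (6 * n + 1)).filter (fun l : ℕ => (p : ℤ) ∣ -(2 * (n : ℤ) + 2 * m) + l) with hT
  have hmem : 2 * n + 2 * m ∈ T := by
    rw [hT, mem_filter, mem_range]; exact ⟨by omega, ⟨0, by push_cast; ring⟩⟩
  have hS : ((range (6 * n + 1)).filter (fun i => i ≠ 2 * n + 2 * m)).filter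
      (fun i : ℕ => (p : ℤ) ∣ (i : ℤ) - 2 * n - 2 * m) = T.erase (2 * n + 2 * m) := by
    ext i
    simp only [hT, mem_filter, mem_range, mem_erase]
    constructor
    · rintro ⟨⟨hi, hne⟩, hd⟩
      exact ⟨hne, hi, by rw [show -(2 * (n : ℤ) + 2 * m) + i = (i : ℤ) - 2 * n - 2 * m by ring]; exact hd⟩
    · rintro ⟨hne, hi, hd⟩
      exact ⟨⟨hi, hne⟩, by rw [show ((i : ℤ) - 2 * n - 2 * m) = -(2 * (n : ℤ) + 2 * m) + i by ring]; exact hd⟩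
  rw [hS, card_erase_of_mem hmem]
  have hTpos : 1 ≤ T.card := card_pos.2 ⟨_, hmem⟩
  have : ((T.card - 1 : ℕ) : ℤ) = (T.card : ℤ) - 1 := by omega
  rw [this, hfull]
  push_cast
  ring

/-- `#{k ≤ n, k ≠ m : p ∣ k − m} = ⌊m/p⌋ + ⌊(n−m)/p⌋` (for `m ≤ n`).
[cite: RivoalZudilin2020, §3 (proof of Proposition 1 (ii), v_p via ⌊·⌋)] -/
theorem card_filter_poles (n : ℕ) {m : ℕ} (hm : m ≤ n) {p : ℕ} (hp : 0 < p) :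
    ((((range (n + 1)).filter (fun l => l ≠ m)).filter (fun l : ℕ => (p : ℤ) ∣ (l : ℤ) - m)).card : ℤ)
      = ((m / p : ℕ) : ℤ) + (((n - m) / p : ℕ) : ℤ) := by
  have hp' : (0 : ℤ) < p := by exact_mod_cast hp
  have hfull := card_filter_dvd_range (-(m : ℤ)) (n + 1) hp'
  have e1 : (-(m : ℤ) + ((n + 1 : ℕ) : ℤ) - 1) = ((n - m : ℕ) : ℤ) := by
    push_cast [Nat.cast_sub hm]; ring
  have e2 : (-(m : ℤ) - 1) = -((m : ℕ) : ℤ) - 1 := by ring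
  rw [e1, e2, Int.neg_sub_one_ediv_eq _ hp', ← Int.natCast_div, ← Int.natCast_div] at hfull
  set T := (range (n + 1)).filter (fun l : ℕ => (p : ℤ) ∣ -(m : ℤ) + l) with hT
  have hmem : m ∈ T := by
    rw [hT, mem_filter, mem_range]; exact ⟨by omega, ⟨0, by ring⟩⟩
  have hS : ((range (n + 1)).filter (fun l => l ≠ m)).filter (fun l : ℕ => (p : ℤ) ∣ (l : ℤ) - m)
      = T.erase m := by
    ext l
    simp only [hT, mem_filter, mem_range, mem_erase]
    constructor
    · rintro ⟨⟨hl, hne⟩, hd⟩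
      exact ⟨hne, hl, by rw [show -(m : ℤ) + l = (l : ℤ) - m by ring]; exact hd⟩
    · rintro ⟨hne, hl, hd⟩
      exact ⟨⟨hl, hne⟩, by rw [show ((l : ℤ) - m) = -(m : ℤ) + l by ring]; exact hd⟩
  rw [hS, card_erase_of_mem hmem]
  have hTpos : 1 ≤ T.card := card_pos.2 ⟨_, hmem⟩
  have : ((T.card - 1 : ℕ) : ℤ) = (T.card : ℤ) - 1 := by omega
  rw [this, hfull]
  push_cast
  ring

/-! ### `p`-adic exponents of the factors at `t = −m` (`p² > 4n`) -/

section padic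

variable {p : ℕ} [hp : Fact p.Prime]

/-- The compact form `F(t)(t+m)^5` has `IsDOrdDiv` exponent `ρ(n/p, m/p)` at `−m`, for a prime `p` with
`p² > 4n`: "`v_p((F(t)(t+m)^5)_{t=−m}) = ρ(n/p,m/p)`" extended to all divided derivatives along
"the lines of the proof of [zud3]". [cite: RivoalZudilin2020, §3 (proof of Proposition 1 (ii))] -/
theorem Fcompact_isDOrdDiv (n : ℕ) {m : ℕ} (hm : m ≤ n) (hp2 : 4 * n < p ^ 2) (N : ℕ) :
    IsDOrdDiv p (rhoZ n m p) N (Fcompact n m) (-(m : ℚ)) := by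
  have hp0 : 0 < p := hp.out.pos
  -- numerator factors
  have hnum : IsDOrdDiv p
      (∑ i ∈ (range (6 * n + 1)).filter (fun i => i ≠ 2 * n + 2 * m),
        (if (p : ℤ) ∣ (i : ℤ) - 2 * n - 2 * m then (1 : ℤ) else 0)) N
      (fun t : ℚ => ∏ i ∈ (range (6 * n + 1)).filter (fun i => i ≠ 2 * n + 2 * m), (2 * t - 2 * n + i))
      (-(m : ℚ)) := by
    refine IsDOrdDiv.prod _ fun i _ => ?_
    have h := isDOrdDiv_two_mul_add_const p (c := ((i : ℚ) - 2 * n)) (x := -(m : ℚ))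
      ((i : ℤ) - 2 * n - 2 * m) (by push_cast; ring) N
    exact h.congr (Eventually.of_forall fun t => by ring)
  -- pole factors
  have hden : IsDOrdDiv p
      (∑ l ∈ (range (n + 1)).filter (fun l => l ≠ m),
        (6 : ℤ) * (if (p : ℤ) ∣ (l : ℤ) - m then -1 else 0)) N
      (fun t : ℚ => ∏ l ∈ (range (n + 1)).filter (fun l => l ≠ m), ((t + l)⁻¹) ^ 6) (-(m : ℚ)) := by
    refine IsDOrdDiv.prod _ fun l hl => ?_
    have hl' := mem_filter.1 hl
    have hlr := mem_range.1 hl'.1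
    have hz0 : (l : ℤ) - m ≠ 0 := sub_ne_zero.2 (by exact_mod_cast hl'.2)
    have hv : padicValInt p ((l : ℤ) - m) ≤ 1 := by
      refine padicValInt_le_one_of_abs_lt_sq p hz0 ?_
      have : |(l : ℤ) - m| ≤ n := by rw [abs_le]; constructor <;> omega
      have h4 : ((4 * n : ℕ) : ℤ) < ((p ^ 2 : ℕ) : ℤ) := by exact_mod_cast hp2
      push_cast at h4
      linarith
    have h := isDOrdDiv_inv_add_const_pow p (c := (l : ℚ)) (x := -(m : ℚ)) ((l : ℤ) - m)
      (by push_cast; ring) hz0 hv 6 N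
    exact h.mono (le_of_eq (by push_cast; ring))
  have hprod := hnum.mul hden
  -- the exponent is `ρ`
  have hexp : (∑ i ∈ (range (6 * n + 1)).filter (fun i => i ≠ 2 * n + 2 * m),
        (if (p : ℤ) ∣ (i : ℤ) - 2 * n - 2 * m then (1 : ℤ) else 0)) +
      (∑ l ∈ (range (n + 1)).filter (fun l => l ≠ m),
        (6 : ℤ) * (if (p : ℤ) ∣ (l : ℤ) - m then -1 else 0)) = rhoZ n m p := by
    rw [sum_boole, card_filter_compact_num n hm hp0]
    have hneg : ∀ l : ℕ, (6 : ℤ) * (if (p : ℤ) ∣ (l : ℤ) - m then -1 else 0)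
        = -6 * (if (p : ℤ) ∣ (l : ℤ) - m then 1 else 0) := fun l => by split_ifs <;> ring
    simp_rw [hneg]
    rw [← mul_sum, sum_boole, card_filter_poles n hm hp0, rhoZ]
    ring
  rw [← hexp]
  exact hprod.congr (Eventually.of_forall fun t => rfl)

/-- The brick form `F(t)(t+m)^5` has `IsDOrdDiv` exponent `ρ(n/p, m/p)` at `−m` (`p² > 4n`).
[cite: RivoalZudilin2020, §3 (proof of Proposition 1 (ii), "Φ_n^{-1} d_n^k (1/k!)(F(t)(t+m)^5)^{(k)} ∈ ℤ")] -/
theorem Fbrick_isDOrdDiv (n : ℕ) {m : ℕ} (hm : m ≤ n) (hp2 : 4 * n < p ^ 2) (N : ℕ) :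
    IsDOrdDiv p (rhoZ n m p) N (Fbrick n m) (-(m : ℚ)) :=
  (Fcompact_isDOrdDiv n hm hp2 N).congr (Fcompact_eventuallyEq_Fbrick n hm)

/-- `G(t)(t+m) = n!/∏_{k≠m}(t+k)` has `IsDOrdDiv` exponent `≥ 0` at `−m` (`p² > n` suffices; we assume `p² > 4n`):
`ord_p n! ≥ ⌊n/p⌋ ≥ ⌊m/p⌋ + ⌊(n−m)/p⌋`. [cite: RivoalZudilin2020, §3 (proof of Proposition 1 (ii), G(t))] -/
theorem Greg_isDOrdDiv (n : ℕ) {m : ℕ} (hm : m ≤ n) (hp2 : 4 * n < p ^ 2) (N : ℕ) :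
    IsDOrdDiv p 0 N (Greg n m) (-(m : ℚ)) := by
  have hp0 : 0 < p := hp.out.pos
  have hden : IsDOrdDiv p
      (∑ l ∈ (range (n + 1)).filter (fun l => l ≠ m), (if (p : ℤ) ∣ (l : ℤ) - m then (-1 : ℤ) else 0)) N
      (fun t : ℚ => ∏ l ∈ (range (n + 1)).filter (fun l => l ≠ m), (t + l)⁻¹) (-(m : ℚ)) := by
    refine IsDOrdDiv.prod _ fun l hl => ?_
    have hl' := mem_filter.1 hl
    have hlr := mem_range.1 hl'.1
    have hz0 : (l : ℤ) - m ≠ 0 := sub_ne_zero.2 (by exact_mod_cast hl'.2)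
    have hv : padicValInt p ((l : ℤ) - m) ≤ 1 := by
      refine padicValInt_le_one_of_abs_lt_sq p hz0 ?_
      have : |(l : ℤ) - m| ≤ n := by rw [abs_le]; constructor <;> omega
      have h4 : ((4 * n : ℕ) : ℤ) < ((p ^ 2 : ℕ) : ℤ) := by exact_mod_cast hp2
      push_cast at h4
      linarith
    exact isDOrdDiv_inv_add_const p (c := (l : ℚ)) (x := -(m : ℚ)) ((l : ℤ) - m) (by push_cast; ring) hz0 hv N
  have hconst : PadicOrdGe p (padicValNat p n ! : ℤ) ((n ! : ℕ) : ℚ) :=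
    PadicOrdGe.of_eq (by rw [padicValRat.of_nat])
  have h := hden.const_mul hconst
  have hexp : (0 : ℤ) ≤ (padicValNat p n ! : ℤ) +
      ∑ l ∈ (range (n + 1)).filter (fun l => l ≠ m), (if (p : ℤ) ∣ (l : ℤ) - m then (-1 : ℤ) else 0) := by
    have hneg : ∀ l : ℕ, (if (p : ℤ) ∣ (l : ℤ) - m then (-1 : ℤ) else 0)
        = -(if (p : ℤ) ∣ (l : ℤ) - m then 1 else 0) := fun l => by split_ifs <;> ring
    simp_rw [hneg]
    rw [sum_neg_distrib, sum_boole, card_filter_poles n hm hp0]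
    have hleg : n / p ≤ padicValNat p n ! := div_le_padicValNat_factorial p n
    have hadd : m / p + (n - m) / p ≤ n / p := by
      have := Nat.add_div_le_add_div m (n - m) p
      rwa [Nat.add_sub_cancel' hm] at this
    omega
  refine (h.mono hexp).congr (Eventually.of_forall fun t => ?_)
  rw [Greg_eq n hm]

/-- **`ord_p (1/a!) (R(t)(t+m)^A)^{(a)}|_{t=−m} ≥ 3ρ(n/p,m/p) − a ≥ 3ρ₀(n/p) − a`** for every `a` and every prime
`p` with `p² > 4n` (Leibniz over `R = (2t+n)F³G^{A−15}`): the `p`-part of "`Φ_n^{−3} d_n^{A−j} p_{j,m} ∈ ℤ`".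
[cite: RivoalZudilin2020, §3 (proof of Proposition 1 (ii), "Φ_n^{-3} d_n^{A-j} p_{j,m} ∈ ℤ")] -/
theorem RregBrick_isDOrdDiv (A n : ℕ) {m : ℕ} (hm : m ≤ n) (hp2 : 4 * n < p ^ 2) (N : ℕ) :
    IsDOrdDiv p (3 * rhoZ n m p) N (RregBrick A n m) (-(m : ℚ)) := by
  have hlin : IsDOrdDiv p 0 N (fun t : ℚ => 2 * t + n) (-(m : ℚ)) := by
    have h := isDOrdDiv_two_mul_add_const p (c := (n : ℚ)) (x := -(m : ℚ)) ((n : ℤ) - 2 * m)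
      (by push_cast; ring) N
    exact h.mono (by split_ifs <;> omega)
  have hF := (Fbrick_isDOrdDiv n hm hp2 N).pow 3
  have hG := (Greg_isDOrdDiv n hm hp2 N).pow (A - 15)
  have h := (hlin.mul hF).mul hG
  refine (h.mono (le_of_eq ?_)).congr (Eventually.of_forall fun t => rfl)
  push_cast; ring

/-- The bound at one order, with the printed `ρ₀`: `ord_p 𝒟_a (R(t)(t+m)^A)(−m) ≥ 3ρ₀(n/p) − a` (`p² > 4n`).
[cite: RivoalZudilin2020, §3 (proof of Proposition 1 (ii), "Φ_n^{-3} d_n^{A-j} p_{j,m} ∈ ℤ")] -/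
theorem padicOrdGe_divDeriv_RregBrick (A n : ℕ) {m : ℕ} (hm : m ≤ n) (hp2 : 4 * n < p ^ 2) (a : ℕ) :
    PadicOrdGe p (3 * (rho0Nat n p : ℤ) - a) (divDeriv a (RregBrick A n m) (-(m : ℚ))) := by
  have h := (RregBrick_isDOrdDiv A n hm hp2 a).padicOrdGe le_rfl
  have hle := rho0Nat_le_rhoZ hp.out.pos hm
  exact h.mono (by linarith)

end padic

end Literature.NumberTheory.Irrationality.RivoalZudilin2020
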